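import Literature.NumberTheory.EllipticCurves.Kato2004.IwasawaH2DescentRankOne
import Literature.NumberTheory.EllipticCurves.Kato2004.IwasawaH2DataOfInjectivityProofs
import Literature.NumberTheory.EllipticCurves.IwasawaSelmerTorsionProofs
import Literature.NumberTheory.EllipticCurves.KatoRankBoundSelmerProofs
import Mathlib.LinearAlgebra.Dimension.Torsion.Finite
import Mathlib.LinearAlgebra.Dimension.Localization
import HarnessLib

/-!
# Kato 2004 (Astérisque 295) §14.14 (14.14.1) in the rank-one case: the RI conjunct
# `finite_descentCokernel_of_rankOne` REDUCED to (14.14.1)-injectivity, Thm. 12.4 (2) and ONE base-level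
# rank statement `rank_{ℤ_p} H¹(ℤ[1/p], T_pW) ≤ 1` — proofs only

Topic `NumberTheory/EllipticCurves`, sub-directory `Kato2004` (namespace = path).  Cell `bsd-cn100`,
prover seat `bsd-cn100-s2-c3` (g11).  Companion of `Kato2004/IwasawaH2DescentRankOne.lean` (the named
fact `finite_descentCokernel_of_rankOne`, 9th conjunct of the citation-borne stub `stub_refereedInputs`
of the registered lines `kato-zeta-perrin-riou` v1e on stmt-BirchSwinnertonDyer-19080 / -19160) and of
`Kato2004/IwasawaH2DataOfInjectivityProofs.lean` (calibration of the 7th conjunct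
`nonempty_iwasawaH2Data` as the injectivity half (α) of (14.14.1) on the pin).

## What is proved (no definition, no named fact; everything a theorem)

Write `A := H¹(ℤ[1/p], T_pW)` for the tree's `integralH1 (tateRep W p) p (κ.layerSubgroup 0)` (a
`ℤ_p`-module, finitely generated by `module_finite_integralH1_layerZero`, file `IntegralH1FiniteProofs`)
and `B := proj₀(𝐇¹_Γ/T) ⊆ A` for the image of a pinned `I : IwasawaH1Data W p κ γ`; the fact says
`A/B` (`IwasawaH1Data.descentCokernel I`) is finite when `rank_ℤ W(ℚ) = 1` and `Ш(W)[p^∞]` is finite.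

* `IwasawaH1Data.exists_proj_zero_not_isOfFinAddOrder` — if (α) `proj₀ x = 0 → x ∈ T·𝐇¹_Γ` holds on
  the pin and `𝐇¹_Γ = I.H` is a finitely generated, torsion-free, NON-ZERO `Λ`-module, then some
  `proj₀ h` has infinite order: otherwise a uniform `p^e` kills `B` (`B` is finitely generated over
  `ℤ_p`), so `p^e·𝐇¹_Γ ⊆ T·𝐇¹_Γ` by (α), and Greenberg's exercise
  (`IwasawaDual.isTorsion_of_forall_nsmul_eq_X_smul`: `N·X ⊆ T·X ⇒ X` is `Λ`-torsion) makes the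
  torsion-free `𝐇¹_Γ` vanish.
* `IwasawaH1Data.finite_descentCokernel_of_rank_le_one` — PIN LEVEL: (α) ∧ `I.H` finitely generated,
  torsion free, `≠ 0` ∧ `rank_{ℤ_p} A ≤ 1` ⟹ `Finite (descentCokernel I)`: `B` has positive rank, so
  `rank (A/B) = 0` by rank–nullity over the domain `ℤ_p`, i.e. `A/B` is a finitely generated torsion
  `ℤ_p`-module, which is finite (`ZpCorank.finite_torsion`).
* `finite_descentCokernel_of_rankOne_of_rank_le_one` — FACT LEVEL: the named fact
  `finite_descentCokernel_of_rankOne` follows from `nonempty_iwasawaH2Data` (⟺ (α), file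
  `IwasawaH2DataOfInjectivityProofs`), `thm12_4` (only its clauses (12.2.1) and 12.4 (2) are used) and the
  DISPLAYED hypothesis
  (R1) `∀ W p κ, rank_ℤ W(ℚ) = 1 → #Ш(W)[p^∞] < ∞ → Module.rank ℤ_[p] H¹(ℤ[1/p], T_pW) ≤ 1`
  (at the bottom layer `κ.layerSubgroup 0`); and `…_of_forall_isTopGenerator_…` — the same with (α) in
  the shape of the door `nonempty_iwasawaH2Data_of_forall_isTopGenerator`.

## Why (the calibration this records)

On Kato's genuine objects the fact is (14.14.1) + Thm. 12.4 (1) + (14.14.2) + the Poitou–Tate sequence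
(14.9.3) (module docstring of `IwasawaH2DescentRankOne.lean`, steps (R1)–(R5)).  The theorems here show
that, GIVEN the two other Kato conjuncts of the stub ((α) and Thm. 12.4 (2)), its whole content is the
base-level inequality (R1) — no `𝐇²`, no (14.14.2), no characteristic-ideal calculus: (α) and
12.4 (2) give `rank_{ℤ_p} B ≥ 1`, so finiteness of `A/B` is EQUIVALENT to `rank_{ℤ_p} A ≤ 1` (the
converse direction `rank A = rank B ≤ rank_{ℤ_p} 𝐇¹_Γ/T = 1` is not needed by the road and not proved
here).  (R1) is the rank-one case of `dim H¹(ℤ[1/p], V_pE) = 1 + dim H²(ℤ[1/p], V_pE)` with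
`H² = 0 ⟸ Sel_st` finite (Kato 14.13, (14.9.3) p. 240); inside the tree it is within reach of the PROVED
reciprocity law `GaloisCohomology.poitouTate_sum_localTatePairing_eq_zero_holds`, local Tate duality at
`p`, and the discharged conjunct `locP_kernel_isTorsion_of_rankOne_holds` (road recorded on the cell bus;
not attempted in this file).  HONEST FRAMING: conditional reductions only; no named fact is discharged;
nothing about the Perrin-Riou formula, crux B, the leaf or BSD.  No `instance`, no notation.

## References

* K. Kato, *p-adic Hodge theory and values of zeta functions of modular forms*, Astérisque 295 (2004):
  §12.2 (12.2.1) (p. 220), Thm. 12.4 (2) (p. 221), §14.13–14.14 (14.14.1) (p. 243), §14.9 (14.9.3)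
  (p. 240). [Kato2004Asterisque]
* R. Greenberg, *Iwasawa theory for elliptic curves*, LNM 1716 (1999), §1 p. 61 (the exercise
  «`X/TX` finite ⇒ `X` torsion»). [GreenbergLNM1716]
* Tree: `Kato2004/IwasawaH2DescentRankOne.lean` (`descentCokernel`, `projZeroIntegral`),
  `Kato2004/IntegralH1FiniteProofs.lean` ((β) `module_finite_integralH1_layerZero`),
  `Kato2004/IwasawaH2DataOfInjectivityProofs.lean` (the (α) doors), `IwasawaSelmerTorsionProofs.lean`
  (`IwasawaDual.isTorsion_of_forall_nsmul_eq_X_smul`), `KatoRankBoundSelmerProofs.lean`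
  (`ZpCorank.finite_torsion`, `ZpCorank.exists_pow_smul_torsion_eq_zero`).
-/

noncomputable section

open Field
open Literature.NumberTheory.GaloisRepresentations
open Literature.NumberTheory.EllipticCurves Literature.NumberTheory.EllipticCurves.Kato2004
open Literature.NumberTheory.EllipticCurves.Kato2004.EulerSystemValues
open Literature.NumberTheory.EllipticCurves.IwasawaAlgebra

namespace Literature.NumberTheory.EllipticCurves.Kato2004

/-! ## §1 Two `ℤ_p`-module lemmas -/

namespace DescentCokernelFinite

variable (p : ℕ) [Fact p.Prime]

/-- A finitely generated TORSION `ℤ_p`-module is finite (it is its own torsion submodule, which is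
finite for every finitely generated `ℤ_p`-module: `ZpCorank.finite_torsion`). [folklore] -/
private theorem finite_of_isTorsion (N : Type*) [AddCommGroup N] [Module ℤ_[p] N] [Module.Finite ℤ_[p] N]
    (h : Module.IsTorsion ℤ_[p] N) : Finite N := by
  have htop : Submodule.torsion ℤ_[p] N = ⊤ := by
    rw [eq_top_iff]
    intro x _
    exact h (x := x)
  haveI := ZpCorank.finite_torsion p N
  exact Finite.of_equiv _ (LinearEquiv.ofTop _ htop).toEquiv

/-- In a `ℤ_p`-module, an element killed by a non-zero `p`-adic integer has finite additive order
(`a = u·p^v` with `u` a unit, so `p^v • x = 0`). [folklore] -/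
private theorem isOfFinAddOrder_of_smul_eq_zero {N : Type*} [AddCommGroup N] [Module ℤ_[p] N] {a : ℤ_[p]}
    (ha : a ≠ 0) {x : N} (hx : a • x = 0) : IsOfFinAddOrder x := by
  have hp : p.Prime := Fact.out
  set u := PadicInt.unitCoeff ha
  have h1 : ((p : ℤ_[p]) ^ a.valuation) • x = 0 := by
    have e : (p : ℤ_[p]) ^ a.valuation = ((u⁻¹ : ℤ_[p]ˣ) : ℤ_[p]) * a := by
      conv_rhs => rw [PadicInt.unitCoeff_spec ha]
      rw [← mul_assoc, Units.inv_mul, one_mul]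
    rw [e, mul_smul, hx, smul_zero]
  refine isOfFinAddOrder_iff_nsmul_eq_zero.mpr ⟨p ^ a.valuation, pow_pos hp.pos _, ?_⟩
  rw [← Nat.cast_smul_eq_nsmul ℤ_[p], Nat.cast_pow]
  exact h1

/-- **Rank bookkeeping over `ℤ_p`.**  Let `A` be a finitely generated `ℤ_p`-module with
`rank_{ℤ_p} A ≤ 1` and `B ⊆ A` a submodule containing an element of infinite order.  Then `A/B` is
finite: `rank B ≥ 1` (an element of infinite order is not torsion), rank–nullity over the domain `ℤ_p`
gives `rank (A/B) = 0`, so `A/B` is a finitely generated torsion module, hence finite. [folklore] -/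
private theorem finite_quotient_of_rank_le_one {A : Type*} [AddCommGroup A] [Module ℤ_[p] A]
    [Module.Finite ℤ_[p] A] (hA : Module.rank ℤ_[p] A ≤ 1) (B : Submodule ℤ_[p] A) {b : A}
    (hbB : b ∈ B) (hb : ¬ IsOfFinAddOrder b) : Finite (A ⧸ B) := by
  haveI : IsNoetherian ℤ_[p] A := isNoetherian_of_isNoetherianRing_of_finite ℤ_[p] A
  haveI : Module.Finite ℤ_[p] B := Module.IsNoetherian.finite ℤ_[p] B
  -- `B` is not torsion, so `finrank B ≠ 0`
  have hBtors : ¬ Module.IsTorsion ℤ_[p] B := by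
    intro htors
    obtain ⟨⟨a, ha⟩, hab⟩ := @htors ⟨b, hbB⟩
    have ha0 : (a : ℤ_[p]) ≠ 0 := nonZeroDivisors.ne_zero ha
    have hab' : a • b = 0 := by
      have := congrArg Subtype.val hab
      simpa using this
    exact hb (isOfFinAddOrder_of_smul_eq_zero p ha0 hab')
  have hB : Module.finrank ℤ_[p] B ≠ 0 := by
    rwa [Ne, Module.finrank_eq_zero_iff_isTorsion]
  -- rank–nullity
  have hAfin : Module.finrank ℤ_[p] A ≤ 1 := Module.finrank_le_of_rank_le (by exact_mod_cast hA)
  have hsum := Submodule.finrank_quotient_add_finrank B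
  have hQ : Module.finrank ℤ_[p] (A ⧸ B) = 0 := by omega
  rw [Module.finrank_eq_zero_iff_isTorsion] at hQ
  exact finite_of_isTorsion p (A ⧸ B) hQ

end DescentCokernelFinite

open DescentCokernelFinite

/-! ## §2 Pin level: (α) + Thm. 12.4 (2) give an element of `proj₀(𝐇¹_Γ)` of infinite order -/

namespace IwasawaH1Data

variable {W : WeierstrassCurve ℚ} [W.IsElliptic] {p : ℕ} [Fact p.Prime]
  [ContinuousSMul ℤ_[p] (W.tateModule p)] {κ : ZpExtension ℚ p} {γ : absoluteGaloisGroup ℚ}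
  (I : IwasawaH1Data W p κ γ)

/-- `ℤ_p`-linearity of `proj₀` in the form used here: `proj₀ ((c : Λ) • x) = c • proj₀ x` for a
natural number `c` (constants act through the `ℤ_p`-structure of the layer, `proj_C_smul`).
[cite: Kato2004Asterisque, §12.2 (p. 220)] -/
theorem proj_natCast_smul (c : ℕ) (n : ℕ) (x : I.H) :
    I.proj n ((c : IwasawaAlgebra p) • x) = (c : ℤ_[p]) • I.proj n x := by
  rw [← map_natCast (PowerSeries.C (R := ℤ_[p])) c, I.proj_C_smul]

/-- **A uniform `p`-power killing `proj₀(𝐇¹_Γ)` forces `𝐇¹_Γ = 0`** (for `𝐇¹_Γ` finitely generated and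
torsion free, under (α)): if `p^e • proj₀ h = 0` for all `h`, then by (α) `p^e·𝐇¹_Γ ⊆ T·𝐇¹_Γ`, so `𝐇¹_Γ`
is `Λ`-torsion (Greenberg's exercise `IwasawaDual.isTorsion_of_forall_nsmul_eq_X_smul`), hence zero.
[cite: GreenbergLNM1716, §1 p. 61] [cite: Kato2004Asterisque, §14.14 (14.14.1) (p. 243)] -/
theorem subsingleton_of_pow_smul_proj_zero_eq_zero [Module.Finite (IwasawaAlgebra p) I.H]
    [Module.IsTorsionFree (IwasawaAlgebra p) I.H]
    (hα : ∀ x : I.H, I.proj 0 x = 0 → x ∈ TSubmodule p I.H) {e : ℕ}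
    (he : ∀ h : I.H, ((p : ℤ_[p]) ^ e) • I.proj 0 h = 0) : Subsingleton I.H := by
  have hp : p.Prime := Fact.out
  have hN : p ^ e ≠ 0 := pow_ne_zero _ hp.ne_zero
  -- `p^e • h ∈ T·𝐇¹` for every `h`
  have hT : ∀ h : I.H, ∃ y : I.H, (p ^ e) • h = (PowerSeries.X : PowerSeries ℤ_[p]) • y := by
    intro h
    have h0 : I.proj 0 (((p ^ e : ℕ) : IwasawaAlgebra p) • h) = 0 := by
      rw [I.proj_natCast_smul, Nat.cast_pow]
      exact he h
    obtain ⟨y, hy⟩ := (mem_TSubmodule_iff p I.H _).mp (hα _ h0)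
    refine ⟨y, ?_⟩
    rw [hy, Nat.cast_smul_eq_nsmul]
  have htors : Module.IsTorsion (IwasawaAlgebra p) I.H :=
    IwasawaDual.isTorsion_of_forall_nsmul_eq_X_smul hN hT
  refine ⟨fun x y ↦ ?_⟩
  rw [← sub_eq_zero]
  obtain ⟨⟨a, ha⟩, hax⟩ := @htors (x - y)
  have ha0 : (a : IwasawaAlgebra p) ≠ 0 := nonZeroDivisors.ne_zero ha
  have hreg : IsRegular (a : IwasawaAlgebra p) := IsRegular.of_ne_zero ha0
  exact (hreg.smul_eq_zero_iff_right).mp hax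

/-- **(α) + «`𝐇¹_Γ` finitely generated, torsion free, non-zero» ⟹ some `proj₀ h` has INFINITE order.**
`B = proj₀(𝐇¹_Γ)`, a `ℤ_p`-submodule of the finitely generated `ℤ_p`-module `H¹(ℤ[1/p], T_pW)`
((β), `module_finite_integralH1_layerZero`), would otherwise be torsion, hence killed by a uniform `p^e`
(`ZpCorank.exists_pow_smul_torsion_eq_zero`), contradicting
`subsingleton_of_pow_smul_proj_zero_eq_zero`. [cite: Kato2004Asterisque, §14.14 (14.14.1) (p. 243) and Thm. 12.4 (2) (p. 221)] -/
theorem exists_proj_zero_not_isOfFinAddOrder [Module.Finite (IwasawaAlgebra p) I.H]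
    [Module.IsTorsionFree (IwasawaAlgebra p) I.H] [Nontrivial I.H]
    (hα : ∀ x : I.H, I.proj 0 x = 0 → x ∈ TSubmodule p I.H) :
    ∃ h : I.H, ¬ IsOfFinAddOrder (I.proj 0 h) := by
  by_contra hall
  push Not at hall
  haveI := module_finite_integralH1_layerZero W p κ
  -- every `proj₀ h`, as an element of the f.g. `ℤ_p`-module `A`, is torsion
  set A := integralH1 (tateRep W p) p (κ.layerSubgroup 0) with hA_def
  obtain ⟨m, hm⟩ := ZpCorank.exists_pow_smul_torsion_eq_zero p A
  have he : ∀ h : I.H, ((p : ℤ_[p]) ^ m) • I.proj 0 h = 0 := by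
    intro h
    have hfin := hall h
    obtain ⟨n, hn, hnx⟩ := hfin.exists_nsmul_eq_zero
    have hmem : (⟨I.proj 0 h, I.proj_mem 0 h⟩ : A) ∈ Submodule.torsion ℤ_[p] A := by
      refine ⟨⟨(n : ℤ_[p]), mem_nonZeroDivisors_of_ne_zero (by exact_mod_cast hn.ne')⟩, ?_⟩
      apply Subtype.ext
      rw [Submonoid.mk_smul, Submodule.coe_smul, Nat.cast_smul_eq_nsmul, Submodule.coe_zero]
      exact hnx
    have := hm _ hmem
    simpa using congrArg Subtype.val this
  haveI := I.subsingleton_of_pow_smul_proj_zero_eq_zero hα he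
  exact false_of_nontrivial_of_subsingleton I.H

/-! ## §3 Pin level: finiteness of the descent cokernel from `rank_{ℤ_p} H¹(ℤ[1/p], T_pW) ≤ 1` -/

/-- **PIN-LEVEL REDUCTION.**  For a pinned `I : IwasawaH1Data W p κ γ` with (α) (`proj₀` injective
modulo `T`), `I.H` finitely generated, torsion free and non-zero over `Λ` (Kato (12.2.1) + Thm. 12.4 (2)),
and `rank_{ℤ_p} H¹(ℤ[1/p], T_pW) ≤ 1` (bottom layer), the descent cokernel
`H¹(ℤ[1/p], T_pW) / proj₀(𝐇¹_Γ/T)` is FINITE.  Proof: §2 gives an element of `proj₀(𝐇¹_Γ)` of infinite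
order; `proj₀(𝐇¹_Γ)` is a `ℤ_p`-submodule (`proj_C_smul`); rank–nullity (§1).
[cite: Kato2004Asterisque, §14.14 (14.14.1) (p. 243), Thm. 12.4 (2) (p. 221)] -/
theorem finite_descentCokernel_of_rank_le_one [Module.Finite (IwasawaAlgebra p) I.H]
    [Module.IsTorsionFree (IwasawaAlgebra p) I.H] [Nontrivial I.H]
    (hα : ∀ x : I.H, I.proj 0 x = 0 → x ∈ TSubmodule p I.H)
    (hrank : Module.rank ℤ_[p] (integralH1 (tateRep W p) p (κ.layerSubgroup 0)) ≤ 1) :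
    Finite I.descentCokernel := by
  haveI := module_finite_integralH1_layerZero W p κ
  set A := integralH1 (tateRep W p) p (κ.layerSubgroup 0) with hA_def
  -- the image of `proj₀` as a `ℤ_p`-SUBMODULE of `A` (underlying subgroup = `projZeroIntegral.range`)
  let B : Submodule ℤ_[p] A :=
    { I.projZeroIntegral.range with
      smul_mem' := by
        rintro c x ⟨q, rfl⟩
        induction q using Submodule.Quotient.induction_on with
        | H h =>
          refine ⟨Submodule.Quotient.mk (PowerSeries.C c • h), Subtype.ext ?_⟩
          change I.projZero _ = c • (I.projZero _ : H1 (tateRep W p) (κ.layerSubgroup 0))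
          rw [IwasawaH1Data.projZero_mk, IwasawaH1Data.projZero_mk, I.proj_C_smul] }
  obtain ⟨h, hh⟩ := I.exists_proj_zero_not_isOfFinAddOrder hα
  have hbB : (⟨I.proj 0 h, I.proj_mem 0 h⟩ : A) ∈ B :=
    ⟨Submodule.Quotient.mk h, Subtype.ext (by
      rw [IwasawaH1Data.coe_projZeroIntegral, IwasawaH1Data.projZero_mk])⟩
  have hb : ¬ IsOfFinAddOrder (⟨I.proj 0 h, I.proj_mem 0 h⟩ : A) := by
    intro hfin
    apply hh
    obtain ⟨n, hn, hnx⟩ := hfin.exists_nsmul_eq_zero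
    exact isOfFinAddOrder_iff_nsmul_eq_zero.mpr ⟨n, hn, by simpa using congrArg Subtype.val hnx⟩
  have hfin : Finite (A ⧸ B) := finite_quotient_of_rank_le_one p hrank B hbB hb
  exact hfin

end IwasawaH1Data

/-! ## §4 Fact level: the RI conjunct from `nonempty_iwasawaH2Data`, `thm12_4` and (R1) -/

/-- **The named fact `finite_descentCokernel_of_rankOne` from the stub's two other Kato conjuncts and the
base-level rank bound (R1).**  Hypotheses: `nonempty_iwasawaH2Data` (⟺ (α) on every pin,
`nonempty_iwasawaH2Data_iff_proj_zero_injective`), `thm12_4` (only (12.2.1) and Thm. 12.4 (2): `𝐇¹_Γ`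
finitely generated, torsion free of `Λ`-rank `1`), and
(R1) `rank_ℤ W(ℚ) = 1 → #Ш(W)[p^∞] < ∞ → rank_{ℤ_p} H¹(ℤ[1/p], T_pW) ≤ 1` (bottom layer of `κ`) —
DISPLAYED, not a named fact.  So modulo the other two conjuncts the 9th RI conjunct of the registered
`kato-zeta-perrin-riou` lines costs exactly (R1).
[cite: Kato2004Asterisque, §14.14 (14.14.1) (p. 243), Thm. 12.4 (2) (p. 221), §14.9 (14.9.3) (p. 240)] -/
theorem finite_descentCokernel_of_rankOne_of_rank_le_one (h2 : nonempty_iwasawaH2Data) (h12 : thm12_4)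
    (hR1 : ∀ (W : WeierstrassCurve ℚ) [W.IsElliptic] (p : ℕ) [Fact p.Prime]
      [ContinuousSMul ℤ_[p] (W.tateModule p)] (κ : ZpExtension ℚ p),
      W.mordellWeilRank = 1 → Finite (AddCommGroup.primaryComponent W.sha p) →
        Module.rank ℤ_[p] (integralH1 (tateRep W p) p (κ.layerSubgroup 0)) ≤ 1) :
    finite_descentCokernel_of_rankOne := by
  intro W _ p _ _ κ γ hκ hγ I hrank hsha
  obtain ⟨hfg, ⟨htf, hrk⟩, -⟩ := h12 W p κ γ hκ hγ I
  haveI := hfg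
  haveI := htf
  haveI : Nontrivial I.H := by
    by_contra hnt
    rw [not_nontrivial_iff_subsingleton] at hnt
    have h0 : Module.rank (IwasawaAlgebra p) I.H = 0 := rank_subsingleton' _ _
    rw [hrk] at h0
    exact one_ne_zero h0
  exact I.finite_descentCokernel_of_rank_le_one
    (fun x hx ↦ (proj_zero_eq_zero_iff_mem_TSubmodule_of_nonempty h2 W p hκ hγ I x).mp hx)
    (hR1 W p κ hrank hsha)

/-- The same with (α) in the shape of the door `nonempty_iwasawaH2Data_of_forall_isTopGenerator` (the
form in which Kato's (14.14.1) injectivity is being proved in the tree): (α) ∧ `thm12_4` ∧ (R1) ⟹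
`finite_descentCokernel_of_rankOne`. [cite: Kato2004Asterisque, §14.14 (14.14.1) (p. 243), Thm. 12.4 (2) (p. 221)] -/
theorem finite_descentCokernel_of_rankOne_of_forall_isTopGenerator_of_rank_le_one
    (hα : ∀ (W : WeierstrassCurve ℚ) [W.IsElliptic] (p : ℕ) [Fact p.Prime]
      [ContinuousSMul ℤ_[p] (W.tateModule p)] (κ : ZpExtension ℚ p) (γ : absoluteGaloisGroup ℚ),
      κ.IsCyclotomic → κ.IsTopGenerator γ → ∀ (I : IwasawaH1Data W p κ γ) (x : I.H),
        I.proj 0 x = 0 → x ∈ TSubmodule p I.H)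
    (h12 : thm12_4)
    (hR1 : ∀ (W : WeierstrassCurve ℚ) [W.IsElliptic] (p : ℕ) [Fact p.Prime]
      [ContinuousSMul ℤ_[p] (W.tateModule p)] (κ : ZpExtension ℚ p),
      W.mordellWeilRank = 1 → Finite (AddCommGroup.primaryComponent W.sha p) →
        Module.rank ℤ_[p] (integralH1 (tateRep W p) p (κ.layerSubgroup 0)) ≤ 1) :
    finite_descentCokernel_of_rankOne :=
  finite_descentCokernel_of_rankOne_of_rank_le_one (nonempty_iwasawaH2Data_of_forall_isTopGenerator hα)
    h12 hR1

end Literature.NumberTheory.EllipticCurves.Kato2004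

end
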